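import Mathlib

/-!
# Sketch_utd_idea_g70 — the layer-intersection lemma `⋂ₙ ωₙ·ℤ_p⟦X⟧ = 0` and Kim's freeness step, for EVERY prime `p`

utd-idea g70 (2026-08-30) · crux `stmt-BirchSwinnertonDyer-24737`
(`Summit.BirchSwinnertonDyer.BirchSwinnertonDyer.Theses.UniversalToricDescent.TwinAlgMuZeroAtThree`) ·
card `Cruxes/TwinAlgMuZeroAtThree/Ideas/one-point-squeeze.md`, item U1-loc (a′), falsifier F5′.

KIM07-PORT (F5′ resolution, g70): the anticyclotomic signed local condition at a split prime above `3`
is, in print, B. D. Kim, *Compositio Math.* 143 (2007) §3 (relative Lubin–Tate / Honda construction,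
§3.4 «the minus local condition of a ramified `ℤ_p`-extension of `ℚ_p`», Props. 3.16–3.18), stated under
«`p` is an odd prime number greater than 3» (p. 50), and Kim, *Canad. J. Math.* 66 (2014) (the `+` sign,
«`p > 3`»); Hatley–Lei–Vigni (arXiv:2003.10301, Prop. 3.2) state it for odd `p` by citing these.  At `p = 3`
it is therefore a PORT.  This file proves, over Mathlib only and for every prime `p`, the one piece of
commutative algebra in the step Prop. 3.16 ⇒ Prop. 3.17 («`(H⁻)^∨/(γ-1) ≅ ℤ_p` … hence cyclic by
Nakayama; the coranks of `(H⁻)^{Gal(L_∞/L_n)}` are full for all `n`, hence free of rank one»):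

* `eq_zero_of_forall_omega_dvd` : if `ω_n := (1+X)^{p^n} - 1` divides `f ∈ ℤ_p⟦X⟧` for every `n`, then `f = 0`;
* `ideal_eq_bot_of_forall_le_span_omega` : an ideal contained in every `(ω_n)` is `⊥`;
* `quotient_free_of_full_layers` : hence a cyclic `Λ`-module `Λ/I` all of whose layer quotients
  `Λ/(I + ω_n)` have the full `ℤ_p`-rank `p^n` (equivalently `I ≤ (ω_n)`, `Λ/(ω_n)` being `ℤ_p`-free of
  rank `p^n`) is free of rank one.

The proof is prime-independent (reduction mod `p`: `ω_n ≡ X^{p^n}`, `p` prime in `ℤ_p⟦X⟧`, `p`-adic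
descent on the content), which is the point: nothing here sees `p > 3`.
No `sorry`, no new axioms, Mathlib only.
-/

open PowerSeries

namespace Summit.BirchSwinnertonDyer.BirchSwinnertonDyer.Cruxes.TwinAlgMuZeroAtThree.OnePointSqueeze.LayerIntersection

variable {p : ℕ} [hp : Fact p.Prime]

variable (p) in
/-- The layer element `ω_n = (1+X)^{p^n} - 1 ∈ ℤ_p⟦X⟧` (under `γ ↦ 1 + X`: `ω_n ↔ γ^{p^n} - 1`). -/
noncomputable def omega (n : ℕ) : (ℤ_[p])⟦X⟧ := ((1 : (ℤ_[p])⟦X⟧) + X) ^ (p ^ n) - 1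

variable (p) in
/-- Coefficientwise reduction modulo `p`, `ℤ_p⟦X⟧ → 𝔽_p⟦X⟧`. -/
noncomputable def redp : (ℤ_[p])⟦X⟧ →+* (ZMod p)⟦X⟧ := PowerSeries.map (PadicInt.toZMod (p := p))

theorem toZMod_eq_zero_iff_dvd (a : ℤ_[p]) : PadicInt.toZMod a = 0 ↔ (p : ℤ_[p]) ∣ a := by
  rw [← RingHom.mem_ker, PadicInt.ker_toZMod, PadicInt.maximalIdeal_eq_span_p,
    Ideal.mem_span_singleton]

theorem natCast_eq_C : (p : (ℤ_[p])⟦X⟧) = C (p : ℤ_[p]) := by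
  rw [map_natCast]

theorem natCast_dvd_iff (f : (ℤ_[p])⟦X⟧) :
    (p : (ℤ_[p])⟦X⟧) ∣ f ↔ ∀ i, (p : ℤ_[p]) ∣ coeff i f := by
  rw [natCast_eq_C]
  constructor
  · rintro ⟨g, rfl⟩ i
    exact ⟨coeff i g, by rw [coeff_C_mul]⟩
  · intro h
    choose g hg using h
    refine ⟨PowerSeries.mk g, ?_⟩
    ext i
    rw [coeff_C_mul, coeff_mk, hg]

theorem redp_eq_zero_iff (f : (ℤ_[p])⟦X⟧) : redp p f = 0 ↔ (p : (ℤ_[p])⟦X⟧) ∣ f := by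
  rw [natCast_dvd_iff, PowerSeries.ext_iff]
  refine forall_congr' fun i => ?_
  simp only [redp, coeff_map, map_zero, toZMod_eq_zero_iff_dvd]

/-- `p` is a prime element of `ℤ_p⟦X⟧` (kernel of the reduction to the domain `𝔽_p⟦X⟧`). -/
theorem prime_natCast : Prime (p : (ℤ_[p])⟦X⟧) := by
  have hker : RingHom.ker (redp p) = Ideal.span {(p : (ℤ_[p])⟦X⟧)} := by
    ext f
    rw [RingHom.mem_ker, redp_eq_zero_iff, Ideal.mem_span_singleton]
  have hne : (p : (ℤ_[p])⟦X⟧) ≠ 0 := by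
    rw [natCast_eq_C]
    intro h
    exact (PadicInt.prime_p (p := p)).ne_zero (C_injective (h.trans (map_zero _).symm))
  rw [← Ideal.span_singleton_prime hne, ← hker]
  exact RingHom.ker_isPrime (redp p)

/-- `ω_n ≡ X^{p^n} (mod p)`. -/
theorem redp_omega (n : ℕ) : redp p (omega p n) = X ^ (p ^ n) := by
  haveI : CharP ((ZMod p)⟦X⟧) p := charP_of_injective_ringHom (C_injective (R := ZMod p)) p
  simp only [redp, omega, map_sub, map_pow, map_add, map_one, map_X]
  rw [add_pow_char_pow, one_pow, add_sub_cancel_left]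

/-- `p ∤ ω_n`. -/
theorem not_natCast_dvd_omega (n : ℕ) : ¬ (p : (ℤ_[p])⟦X⟧) ∣ omega p n := by
  intro hdvd
  have h0 : redp p (omega p n) = 0 := (redp_eq_zero_iff _).2 hdvd
  rw [redp_omega] at h0
  exact pow_ne_zero _ X_ne_zero h0

/-- If every `ω_n` divides `g`, then `p ∣ g` (reduce mod `p`: `X^{p^n} ∣ ḡ` for all `n`). -/
theorem natCast_dvd_of_forall_omega_dvd (g : (ℤ_[p])⟦X⟧) (hg : ∀ n, omega p n ∣ g) :
    (p : (ℤ_[p])⟦X⟧) ∣ g := by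
  rw [← redp_eq_zero_iff]
  ext i
  rw [map_zero]
  have hX : (X : (ZMod p)⟦X⟧) ^ (p ^ i) ∣ redp p g := by
    rw [← redp_omega]; exact map_dvd (redp p) (hg i)
  exact (X_pow_dvd_iff.1 hX) i (Nat.lt_pow_self hp.out.one_lt)

/-- `p`-adic descent: if every `ω_n` divides `g`, then every power of `p` divides `g`. -/
theorem natCast_pow_dvd_of_forall_omega_dvd (k : ℕ) :
    ∀ g : (ℤ_[p])⟦X⟧, (∀ n, omega p n ∣ g) → (p : (ℤ_[p])⟦X⟧) ^ k ∣ g := by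
  induction k with
  | zero => intro g _; exact ⟨g, by rw [pow_zero, one_mul]⟩
  | succ k ih =>
    intro g hg
    obtain ⟨g₁, rfl⟩ := ih g hg
    have hne : (p : (ℤ_[p])⟦X⟧) ^ k ≠ 0 := pow_ne_zero _ prime_natCast.ne_zero
    have hg₁ : ∀ n, omega p n ∣ g₁ := by
      intro n
      obtain ⟨c, hc⟩ := hg n
      have hpc : (p : (ℤ_[p])⟦X⟧) ^ k ∣ c :=
        prime_natCast.pow_dvd_of_dvd_mul_left k (not_natCast_dvd_omega n) ⟨g₁, hc.symm⟩
      obtain ⟨c₁, rfl⟩ := hpc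
      refine ⟨c₁, mul_left_cancel₀ hne ?_⟩
      rw [hc]; ring
    obtain ⟨g₂, rfl⟩ := natCast_dvd_of_forall_omega_dvd g₁ hg₁
    exact ⟨g₂, by ring⟩

/-- An element of `ℤ_p` divisible by every power of `p` is zero. -/
theorem PadicInt.eq_zero_of_forall_pow_dvd (x : ℤ_[p]) (h : ∀ k : ℕ, (p : ℤ_[p]) ^ k ∣ x) : x = 0 := by
  by_contra hne
  have hpos : 0 < ‖x‖ := norm_pos_iff.2 hne
  have hp1 : ((p : ℝ))⁻¹ < 1 := inv_lt_one_of_one_lt₀ (by exact_mod_cast hp.out.one_lt)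
  obtain ⟨k, hk⟩ := exists_pow_lt_of_lt_one hpos hp1
  have hle : ‖x‖ ≤ (p : ℝ) ^ (-(k : ℤ)) :=
    (PadicInt.norm_le_pow_iff_mem_span_pow x k).2 (Ideal.mem_span_singleton.2 (h k))
  rw [zpow_neg, zpow_natCast, ← inv_pow] at hle
  exact lt_irrefl _ (hle.trans_lt hk)

/-- **Layer-intersection lemma** (all primes `p`): a power series over `ℤ_p` divisible by every
`ω_n = (1+X)^{p^n} - 1` is zero, i.e. `⋂ₙ ω_n ℤ_p⟦X⟧ = 0`. -/
theorem eq_zero_of_forall_omega_dvd (f : (ℤ_[p])⟦X⟧) (h : ∀ n, omega p n ∣ f) : f = 0 := by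
  ext i
  rw [map_zero]
  refine PadicInt.eq_zero_of_forall_pow_dvd _ fun k => ?_
  obtain ⟨g, hg⟩ := natCast_pow_dvd_of_forall_omega_dvd k f h
  refine ⟨coeff i g, ?_⟩
  rw [hg, natCast_eq_C, ← map_pow, coeff_C_mul]

/-- Ideal form: an ideal of `ℤ_p⟦X⟧` contained in every `(ω_n)` is zero. -/
theorem ideal_eq_bot_of_forall_le_span_omega (I : Ideal (ℤ_[p])⟦X⟧)
    (h : ∀ n, I ≤ Ideal.span {omega p n}) : I = ⊥ := by
  refine (Submodule.eq_bot_iff _).2 fun f hf => ?_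
  exact eq_zero_of_forall_omega_dvd f fun n => Ideal.mem_span_singleton.1 (h n hf)

/-- **Kim's freeness step** (Compositio 143, Prop. 3.16 ⇒ 3.17, algebraic form, all `p`): a cyclic
`Λ = ℤ_p⟦X⟧`-module `Λ/I` whose layer quotients `Λ/(I + ω_n)` have full rank for every `n` — i.e.
`I ≤ (ω_n)` for every `n` — is free of rank one. -/
theorem quotient_free_of_full_layers (I : Ideal (ℤ_[p])⟦X⟧)
    (h : ∀ n, I ≤ Ideal.span {omega p n}) :
    Nonempty (((ℤ_[p])⟦X⟧ ⧸ I) ≃ₗ[(ℤ_[p])⟦X⟧] (ℤ_[p])⟦X⟧) :=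
  ⟨Submodule.quotEquivOfEqBot I (ideal_eq_bot_of_forall_le_span_omega I h)⟩

/-- The case of the crux: `p = 3`. -/
example (f : (ℤ_[3])⟦X⟧) (h : ∀ n, omega 3 n ∣ f) : f = 0 :=
  haveI : Fact (Nat.Prime 3) := ⟨Nat.prime_three⟩
  eq_zero_of_forall_omega_dvd f h

end Summit.BirchSwinnertonDyer.BirchSwinnertonDyer.Cruxes.TwinAlgMuZeroAtThree.OnePointSqueeze.LayerIntersection
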